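import Summits.BirchSwinnertonDyer.Rank1Residual.Supersingular.KobayashiConverseReal
import Summits.BirchSwinnertonDyer.Rank1Residual.Supersingular.SignedRankOneCorA5
import Summits.BirchSwinnertonDyer.Rank1Residual.Partition.MainConjecturesCMSupersingular
import Literature.NumberTheory.EllipticCurves.GreenbergVatsal2000.CongruentCurves
import Literature.NumberTheory.EllipticCurves.Rank1Residual.Typed.X7
import HarnessLib

/-!
# Route `SignedLowerHalves`, crux `KobayashiMainConjectureSmallImage` (item stmt-BirchSwinnertonDyer-19002) —
# DEFINITIONS for the «CM-congruence transfer» line: ONE explicitly labelled OPEN hypothesis, the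
# supersingular Greenberg–Vatsal / Emerton–Pollack–Weston transfer of Corpuz–Lei (arXiv:2508.09733, 2025,
# PREPRINT), in the ± currency of the tree (cell `bsd-ssimc`, seat `bsd-ssimc-k3-c4` gen 0)

HONEST FRAMING: an UNREFEREED preprint enters the tree ONLY as an explicitly labelled OPEN hypothesis
(`@[conjecture] def … : Prop` — an OBLIGATION of ours until the preprint is refereed or re-proved here,
filed under `Theorems/<its own name>.lean` as the gate prescribes; nothing asserted; consumers take it
as a binder) — the pattern of
`Summit.….Supersingular.BurungaleSkinnerTianWan2024_thm13_OPEN` and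
`Summit.….Supersingular.FouquetWan2021_thm51_via_kobayashi74_OPEN`. Nothing about any curve is asserted;
nothing is booked. This file declares the binder and its first consumers (the pattern of the
tree's `Theorems/Rank1ResidualX9Defs.lean`: definitions with the theorems that read them).

## Why (the «CM-congruence transfer» line for item 4, cell memo k3c4-MEMO-1 ADDENDUM B)

On the domain of crux `KobayashiMainConjectureSmallImage` (odd good supersingular `p`, `a_p = 0`,
`ρ̄_{E,p}` NOT onto) the image is the normaliser of a non-split Cartan subgroup (b2b:
`GaloisImage/SupersingularNonsplitCartanNormalizer.lean`), i.e. `ρ̄_{E,p} ≅ Ind_K ψ̄` with `K`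
imaginary quadratic and `p` INERT in `K`: such a curve is congruent mod `p` to a weight-2 CM form of `K`,
and for CM ELLIPTIC CURVES at inert `p` Kobayashi's ± main conjecture is a THEOREM (Pollack–Rubin 2004,
tree fact `PollackRubin2004.mainTheorem_signedCharIdeal_eq_of_cm`). Main conjectures transfer along
congruences when `μ = 0` (Greenberg–Vatsal 2000 / Emerton–Pollack–Weston 2006, ordinary; used by the
X9 cell with Hesse-pencil congruence certificates); the supersingular ± transfer is the 2025 PREPRINT
of Corpuz–Lei — the binder below. Window census (seat k3-c4, numerical): 79 of the 136 non-surjective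
open-ish X7 pairs are congruent to a CM elliptic curve (`p = 3`: 57, partner `y² = x³ + Dx`;
`p = 5`: 22, partner `y² = x³ + D`, including the theorem-needed class 26352o1 @ 5).

* `CorpuzLei2025_signedMainConjecture_transfer_OPEN` — the binder (Theorems 1 + 2 + 3 composed, ±
  currency, weight 2, `i = 0`).
* `kobayashiMainConjecture_of_cmPartner_of_transfer_OPEN` — **the line's class theorem**: `W` with
  `p` odd good, `a_p = 0`; a CM partner `W'` (`W'.HasCM`, `GoodSS W' p`, `a_p(W') = 0`) with
  `W[p] ≃ W'[p]` `Γ_ℚ`-equivariantly and `μ(L_p^±(W')) = 0` (unit content of Kobayashi's `L^ε` for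
  every Pollack pair of `W'`'s newform) ⇒ `KobayashiMainConjecture W p ε` for EVERY sign, MODULO the
  binder; everything else PUBLISHED by name (Pollack–Rubin; the period-unit facts `h5`/`h3` to move
  unit content across `ι g = ϖ·ι L^ε`). NO image hypothesis on `W`.
* `X7.bsdp_of_cmPartner_of_transfer_OPEN_of_analyticRank_le_one` — hence `BSD(E,p)` on X7 ∧
  {r_an ≤ 1} for CM-partnered pairs, by the image-free rank-0 road / BKO Cor A.5, MODULO the binder.
* `stub_lowerSmallImage_of_cmPartner_of_transfer_OPEN` — the registered stub `stub_lowerSmallImage`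
  of the BC3 skeleton, header VERBATIM, with the binder + partner data as extra hypotheses.

What is NOT claimed: the binder (PRE); the existence of a CM partner or `μ = 0` for any curve (per
pair: a congruence certificate — Hesse pencils at `p = 3, 5` as in `X9/HessePartner*` — and a
two-engine `μ`-certificate as in `SignedMuVanishing.lean`); anything for the 57 window pairs whose
partner is a CM newform with non-rational coefficients; anything booked.

## Source (READ for this file: materialised text `paper:arxiv-2508.09733`, pp. 3–4 and 15–16)

R. Corpuz, A. Lei, *Congruences of `p`-adic `L`-functions of modular forms at non-ordinary primes*,
arXiv:2508.09733 (August 2025) [CorpuzLei2025]. Setting (p. 3): `p ≥ 3`; `f ∈ S_k(Γ₁(N_f))`,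
`g ∈ S_k(Γ₁(N_g))` normalised cuspidal eigenforms, NON-ORDINARY at `p` (`ord_p a_p > 0`); Assumptions
(1) `f`, `g` are `ϖ^r`-congruent, (2) `p > k` (Fontaine–Laffaille), (3) the coefficient field `E/ℚ_p` is
unramified, (4) both signed `p`-adic `L`-functions `L_p(∗, ♮, ω^i)` are non-zero, (5)
`T_f/ϖ ≅ T_g/ϖ` as `G_ℚ`-representations. **Theorem 1** (= Thm. 5.3): `μ^♮_an(f) = 0 ⟺ μ^♮_an(g) = 0`,
and then the analytic `λ`-invariants differ by local terms at `Σ₀ = {v ∣ N_f N_g}`. **Theorem 2** (= Thm.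
5.9, via Hatley–Lei 2019): the signed Selmer duals `𝒳^♮(∗)^{ω^i}` are torsion and `μ^♮_alg(f) = 0 ⟺
μ^♮_alg(g) = 0`, with the same `λ`-shift. **Theorem 3** (= Thm. 5.10): "If `μ(∗, ω^i)^♮_alg =
μ(∗, ω^i)^♮_an = 0` for `∗ ∈ {f, g}`, then Conjecture (IMC) holds for `𝒳^♮(f)^{ω^i}` if and only if it
holds for `𝒳^♮(g)^{ω^i}`" — Conjecture 5.6 (IMC) being Kato's main conjecture in signed form,
`Char(𝒳^♮(f)^{ω^i}) = (L_p(f, ♮, ω^i)/ξ_{i,♮})` (`ξ_{0,♮} = 1` in weight `2`), whose one inclusion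
"`⊇`" is known RATIONALLY with no image hypothesis (Prop. 5.8, from [LLZ]).

## Transcription (the COMPOSITE «Thm 1 + Thm 2 + Thm 3», `i = 0`, weight `2`, rational coefficients)

For two ELLIPTIC CURVES `E₁ = W₁`, `E₂ = W₂` over `ℚ` (globally minimal models), an odd prime `p` of
good reduction for both with `a_p(E₁) = a_p(E₂) = 0` (non-ordinary; `k = 2 < p` and `E = ℚ_p` make
Assumptions 2–3 automatic; Assumption 4 is Rohrlich, built into the tree's Pollack pairs), and a
`Γ_ℚ`-equivariant additive isomorphism `E₁[p] ≃ E₂[p]` (Assumption 5, hence 1): at `a_p = 0` Sprung's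
`♯/♭` objects are Kobayashi's `∓` ones (Sprung 2012 §1; tree `isSprungPair_zero_iff`) and the
`ω⁰`-component is the cyclotomic `ℤ_p`-extension, so "Conjecture (IMC) for `𝒳^♮(∗)^{ω⁰}`" is read as the
tree's `KobayashiMainConjecture W∗ p ε` (Kobayashi's sign `ε`; Néron normalisation `ϖ·L_p^ε`,
`ϖ·Ω_E = Ω⁺_f` — for irreducible `E[p]` the canonical/Néron period ratio is a `p`-adic unit, Greenberg–
Vatsal 2000 §3, the reading used by the tree's `GreenbergVatsal2000.thm14_mainConjecture_transfer_of_torsionIso`).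
"`μ_alg = 0`" is read, as in that fact, as unit content of a generator of `char X^ε`
(`GreenbergVatsal2000.HasUnitContent`; `muInvariant_eq_zero_iff_hasUnitContent`), and "`μ_an = 0`" as unit
content of `ϖ·L_p^ε`, which under the main conjecture for `E₂` is the same statement. So the composite
reads: IF for `E₂` the signed main conjecture holds WITH UNIT CONTENT (i.e. with `μ^ε_alg = μ^ε_an = 0`),
THEN the signed main conjecture holds for `E₁` (Theorems 1–2 transfer the two `μ = 0` to `E₁`, Theorem 3
transfers the equality). Weaker than the print (the conclusion drops `E₁`'s unit content), never stronger.

References: [CorpuzLei2025] Thms 1–3 (= 5.3, 5.9, 5.10), Conj. 5.6, Prop. 5.8, Assumptions 1–5;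
[Kobayashi2003] Conjecture (p. 2); [GreenbergVatsal2000] §3 and (1)–(2); [Sprung2012] §1 (♯/♭ = ∓ at
`a_p = 0`); [HatleyLei2019] (algebraic side, as cited there).
-/

set_option autoImplicit false
set_option linter.dupNamespace false

noncomputable section

open scoped Classical MatrixGroups ModularForm

open CongruenceSubgroup WeierstrassCurve Literature.NumberTheory.EllipticCurves
  Literature.NumberTheory.EllipticCurves.ModularForms
  Literature.NumberTheory.EllipticCurves.Kobayashi2003 ZpExtension
  Literature.NumberTheory.EllipticCurves.GreenbergVatsal2000
  Summit.BirchSwinnertonDyer.Rank1Residual.Supersingular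

namespace Summit.BirchSwinnertonDyer.BirchSwinnertonDyer.Theorems

/-- **OPEN HYPOTHESIS — UNREFEREED PREPRINT (Corpuz–Lei, arXiv:2508.09733, 2025), Theorems 1 + 2 + 3
composed, for two congruent elliptic curves with `a_p = 0`.** For globally minimal `W₁, W₂ / ℚ`, an odd
prime `p` of good reduction for both with `a_p(W₁) = a_p(W₂) = 0`, and a `Γ_ℚ`-equivariant additive
isomorphism `W₁[p] ≃ W₂[p]`: IF for `W₂` and the sign `ε` Kobayashi's main conjecture holds WITH UNIT
CONTENT — for every cyclotomic datum `(κ, γ)`, the newform `f₂`, the period ratio `ϖ₂`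
(`ϖ₂·Ω_{W₂} = Ω⁺_{f₂}`), every Pollack pair `(L⁺, L⁻)` of `f₂` and every dual datum `D₂` of
`Sel^ε(W₂/ℚ_∞)`, `X^ε` is `Λ`-torsion and `char X^ε = (g₂)` with `HasUnitContent g₂` (`μ = 0`) and
`ι g₂ = ϖ₂ · ι L^ε` — THEN `KobayashiMainConjecture W₁ p ε`. (Print: Thm 1 `μ_an` transfers, Thm 2
`μ_alg` transfers, Thm 3 the signed IMC transfers when all four `μ` vanish; `i = 0`, `k = 2 < p`,
coefficient field `ℚ_p`, `♯/♭ = ∓` at `a_p = 0`.) NEVER cite this `Prop` as a theorem; take it as an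
explicit hypothesis `(hCL : CorpuzLei2025_signedMainConjecture_transfer_OPEN)`. Weaker than the print,
never stronger. [claim: CorpuzLei2025, status: under-review]
[cite: Kobayashi2003, Conjecture (Main Conjecture) (p. 2)] [cite: GreenbergVatsal2000, p. 2, (1)–(2) and §3 Remark 3.4] -/
@[conjecture] def CorpuzLei2025_signedMainConjecture_transfer_OPEN : Prop :=
  ∀ (W₁ W₂ : WeierstrassCurve ℚ) [W₁.IsElliptic] [W₁.IsGloballyMinimal] [W₂.IsElliptic]
    [W₂.IsGloballyMinimal] (p : ℕ) [Fact p.Prime],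
    p ≠ 2 →
    W₁.HasGoodReductionAtPrime p → W₁.frobeniusTrace p = 0 →
    W₂.HasGoodReductionAtPrime p → W₂.frobeniusTrace p = 0 →
    (∃ e : geomTorsion W₁ (p : ℤ) ≃+ geomTorsion W₂ (p : ℤ),
      ∀ (σ : Field.absoluteGaloisGroup ℚ) (P : geomTorsion W₁ (p : ℤ)), e (σ • P) = σ • e P) →
    ∀ (ε : ℤˣ),
    (∀ (κ : ZpExtension ℚ p) (γ : Field.absoluteGaloisGroup ℚ),
        κ.IsCyclotomic → κ.IsTopGenerator γ → IsCyclotomicVariable p γ →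
      ∀ [NeZero (W₂.conductorNorm ℤ)] (f₂ : CuspForm (Gamma0 (W₂.conductorNorm ℤ)) 2),
        IsNewformOf W₂ f₂ → ∀ (ϖ₂ : ℚ), (ϖ₂ : ℝ) * W₂.realPeriodRat = plusPeriod f₂ →
      ∀ (Lplus Lminus : IwasawaAlgebra p), IsPollackPair f₂ p Lplus Lminus →
      ∀ (D₂ : SignedSelmerDualData W₂ κ γ ε), Module.IsTorsion (IwasawaAlgebra p) D₂.X ∧
        ∃ g₂ : IwasawaAlgebra p, D₂.charIdeal = Ideal.span {g₂} ∧ HasUnitContent g₂ ∧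
          iwasawaToPowerSeries p g₂ =
            PowerSeries.C (ϖ₂ : ℚ_[p]) * iwasawaToPowerSeries p (kobayashiL ε Lplus Lminus)) →
    KobayashiMainConjecture W₁ p ε


/-! ### Consumers: the CM-congruence transfer line -/

section Consumers

open Literature.NumberTheory.EllipticCurves.Rank1Residual
  Literature.NumberTheory.EllipticCurves.Rank1Residual.Typed

variable (W W' : WeierstrassCurve ℚ) [W.IsElliptic] [W.IsGloballyMinimal] [W'.IsElliptic]
  [W'.IsGloballyMinimal] (p : ℕ) [Fact p.Prime]

/-- **The CM-congruence transfer (class theorem of the line, MODULO the OPEN binder).** Let `p` be an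
odd prime of good reduction of `E = W` with `a_p = 0` (ANY image), and let `E' = W'` be a CM curve
(`W'.HasCM`) with good supersingular reduction at `p` and `a_p(E') = 0`, congruent to `E` mod `p`
(`hiso`: a `Γ_ℚ`-equivariant `E[p] ≃ E'[p]`) and with `μ(L_p^ε(E')) = 0` for both signs (`hμ'`: unit
content of Kobayashi's `L^ε` for every Pollack pair of the newform of `E'`). Granted BY NAME
Pollack–Rubin 2004 (`hPR`: the ± main conjecture for `E'`), the period-unit facts (`h5`, `h3`:
`ord_p(Ω⁺_f/Ω_E) = 0` at an odd good irreducible prime) and the OPEN binder (`hCL`, Corpuz–Lei 2025,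
PRE): `KobayashiMainConjecture W p ε` for EVERY sign `ε`. Proof: Pollack–Rubin gives `char X^ε(E') =
(g')` with `ι g' = ϖ'·ι L^ε(E')`; `ϖ' ∈ ℤ_p^×` so `g' = C(u)·L^ε(E')` has unit content iff `L^ε(E')`
does; feed the binder. CONDITIONAL on `hCL`; nothing asserted about any curve.
[claim: CorpuzLei2025, status: under-review] [cite: PollackRubin2004, Theorem (p. 448) = Thm. 7.3]
[cite: GreenbergVatsal2000, §3 Remark 3.4] [cite: Kobayashi2003, Conjecture (Main Conjecture) (p. 2)] -/
theorem kobayashiMainConjecture_of_cmPartner_of_transfer_OPEN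
    (hCL : CorpuzLei2025_signedMainConjecture_transfer_OPEN)
    (hPR : PollackRubin2004.mainTheorem_signedCharIdeal_eq_of_cm)
    (h5 : realPeriodRat_eq_unit_mul_plusPeriod) (h3 : realPeriodRat_eq_unit_mul_plusPeriod_three)
    (hp : p ≠ 2) (hgood : W.HasGoodReductionAtPrime p) (hap : W.frobeniusTrace p = 0)
    (hcm' : W'.HasCM) (hss' : GoodSS W' p) (hap' : W'.frobeniusTrace p = 0)
    (hiso : ∃ e : geomTorsion W (p : ℤ) ≃+ geomTorsion W' (p : ℤ),
      ∀ (σ : Field.absoluteGaloisGroup ℚ) (P : geomTorsion W (p : ℤ)), e (σ • P) = σ • e P)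
    (hμ' : ∀ [NeZero (W'.conductorNorm ℤ)] (f' : CuspForm (Gamma0 (W'.conductorNorm ℤ)) 2),
      IsNewformOf W' f' → ∀ (Lplus Lminus : IwasawaAlgebra p), IsPollackPair f' p Lplus Lminus →
      ∀ ε : ℤˣ, HasUnitContent (kobayashiL ε Lplus Lminus))
    (ε : ℤˣ) : KobayashiMainConjecture W p ε := by
  refine hCL W W' p hp hgood hap hss'.1 hap' hiso ε ?_
  intro κ γ hκ hγ hγ' _ f' hf' ϖ' hϖ' Lplus Lminus hL D'
  obtain ⟨htor, g, hg, hι⟩ :=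
    kobayashiMainConjecture_of_pollackRubin_of_goodSS W' p hPR hcm' hp hss' ε κ γ hκ hγ hγ' f' hf' ϖ'
      hϖ' Lplus Lminus hL D'
  refine ⟨htor, g, hg, ?_, hι⟩
  -- the period ratio `ϖ'` is a `p`-adic unit, so `g = C(u) · L^ε` and unit content passes to `g`
  have hirr' : W'.HasIrreducibleModPGaloisRep p :=
    hasIrreducibleModPGaloisRep_of_dvd_frobeniusTrace W' p hp
      (W'.not_dvd_minimalDiscriminantInt_of_hasGoodReductionAtPrime' p hss'.1) hss'.2
  have hvϖ : padicValRat p ϖ' = 0 :=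
    padicValRat_periodRatio_eq_zero h5 h3 W' p hp hss'.1 hirr' f' hf' ϖ' hϖ'
  have hϖ0 : ϖ' ≠ 0 := by
    intro hz
    rw [hz, Rat.cast_zero, zero_mul] at hϖ'
    exact (IsNewform0.plusPeriod_pos_holds hf'.1 hf'.coeffField_eq_bot).ne' hϖ'.symm
  obtain ⟨u, hu⟩ := exists_units_coe_eq_ratCast hϖ0 hvϖ
  obtain ⟨-, hιu⟩ := span_C_units_mul_eq u (kobayashiL ε Lplus Lminus)
  have hgeq : g = PowerSeries.C (u : ℤ_[p]) * kobayashiL ε Lplus Lminus :=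
    iwasawaToPowerSeries_injective p (by rw [hι, hιu, hu])
  rw [hgeq, hasUnitContent_unit_mul_iff ((Units.isUnit u).map PowerSeries.C)]
  exact hμ' f' hf' Lplus Lminus hL ε

/-- **X7 (any image) ∧ {r_an ≤ 1} with a CM partner: `BSD(E,p)` MODULO the OPEN binder** — the
transfer gives `KobayashiMainConjecture W p ε`, and the tree's IMAGE-FREE roads conclude: rank 0 by
`bsdp_of_kobayashiMainConjecture_of_analyticRank_eq_zero` (Kobayashi Thm 1.2 `h12`, Kim Cor 3.15
`hKim`, Pollack `hPollack`, modularity `hmod`/`hmod'`, GZK `hGZK`), rank 1 by Burungale–Kobayashi–Ota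
Cor A.5 (`hA5`). On item 4 (non-surjective image) these are the ONLY roads and both eat the EQUALITY
— which is what the transfer delivers. CONDITIONAL on `hCL`; closes nothing.
[claim: CorpuzLei2025, status: under-review] [cite: PollackRubin2004, Theorem (p. 448) = Thm. 7.3]
[cite: BurungaleKobayashiOta2023, App. A Cor. A.5] [cite: Kobayashi2003, Thm. 1.2 and Conjecture (p. 2)]
[cite: BDKim2013, Cor. 3.15 (p. 199)] [cite: Miller2011LMS, Def. 1.1] -/
theorem X7.bsdp_of_cmPartner_of_transfer_OPEN_of_analyticRank_le_one
    (hCL : CorpuzLei2025_signedMainConjecture_transfer_OPEN)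
    (hPR : PollackRubin2004.mainTheorem_signedCharIdeal_eq_of_cm)
    (h5 : realPeriodRat_eq_unit_mul_plusPeriod) (h3 : realPeriodRat_eq_unit_mul_plusPeriod_three)
    (hA5 : BurungaleKobayashiOta2024.corA5_pPart_of_signedCharIdeal_eq)
    (h12 : Kobayashi2003.thm12_signedSelmerDual_finite_torsion)
    (hKim : BDKim2013.cor315_signedCharValue_rankZero)
    (hPollack : ∀ {N : ℕ} [NeZero N] {f : CuspForm (Gamma0 N) 2},
      pollack_exists_plusMinusPAdicLFunction (W := W) (f := f) (p := p))
    (hmod : nonempty_modularParametrizationData) (hmod' : hasEntireLFunction_rat)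
    (hGZK : rank_eq_analyticRank_of_analyticRank_le_one)
    (hp : p ≠ 2) (hX : ClassX7 W p) (hap : W.frobeniusTrace p = 0)
    (hcm' : W'.HasCM) (hss' : GoodSS W' p) (hap' : W'.frobeniusTrace p = 0)
    (hiso : ∃ e : geomTorsion W (p : ℤ) ≃+ geomTorsion W' (p : ℤ),
      ∀ (σ : Field.absoluteGaloisGroup ℚ) (P : geomTorsion W (p : ℤ)), e (σ • P) = σ • e P)
    (hμ' : ∀ [NeZero (W'.conductorNorm ℤ)] (f' : CuspForm (Gamma0 (W'.conductorNorm ℤ)) 2),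
      IsNewformOf W' f' → ∀ (Lplus Lminus : IwasawaAlgebra p), IsPollackPair f' p Lplus Lminus →
      ∀ ε : ℤˣ, HasUnitContent (kobayashiL ε Lplus Lminus))
    (hr : W.analyticRank ≤ 1) : BSDp W p := by
  have hMC : KobayashiMainConjecture W p 1 :=
    kobayashiMainConjecture_of_cmPartner_of_transfer_OPEN W W' p hCL hPR h5 h3 hp hX.1.1 hap hcm' hss'
      hap' hiso hμ' 1
  rcases Nat.lt_or_ge W.analyticRank 1 with h0 | h1
  · exact bsdp_of_kobayashiMainConjecture_of_analyticRank_eq_zero W p h12 hKim hPollack hmod hmod' hGZK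
      hp hX.1.1 hap (ClassX7.irr W p hp hX) (Nat.lt_one_iff.mp h0) hMC
  · exact bsdp_of_kobayashiMainConjecture_of_corA5_of_analyticRank_eq_one W p hA5 hmod' hGZK hp hX.1.1
      hap (le_antisymm hr h1) 1 hMC

end Consumers

/-- **The registered stub `stub_lowerSmallImage` of crux `KobayashiMainConjectureSmallImage` (header
VERBATIM) for CM-PARTNERED pairs, MODULO the OPEN binder.** Extra leading binders: the Corpuz–Lei
transfer (`hCL`, PRE), Pollack–Rubin (`hPR`), the period-unit facts (`h5`, `h3`), and — per curve —
the CM partner data (`hpartner`: a CM `W'` good supersingular at `p` with `a_p(W') = 0`, a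
`Γ_ℚ`-equivariant `W[p] ≃ W'[p]`, and unit content of `W'`'s `L_p^±`). Then the Eisenstein half holds
for SOME (indeed every) sign — in fact the full equality. The binders `¬CM`, `¬Surj`, `ClassX7` of the
stub are carried unused (the transfer is image-free; a CM-congruent curve at an inert `p ≥ 3` has
small image automatically). CONDITIONAL; closes nothing. [claim: CorpuzLei2025, status: under-review]
[cite: PollackRubin2004, Theorem (p. 448) = Thm. 7.3] [cite: Kobayashi2003, Conjecture (Main Conjecture) (p. 2)] -/
theorem stub_lowerSmallImage_of_cmPartner_of_transfer_OPEN
    (hCL : CorpuzLei2025_signedMainConjecture_transfer_OPEN)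
    (hPR : PollackRubin2004.mainTheorem_signedCharIdeal_eq_of_cm)
    (h5 : realPeriodRat_eq_unit_mul_plusPeriod) (h3 : realPeriodRat_eq_unit_mul_plusPeriod_three) :
    ∀ (W : WeierstrassCurve ℚ) [W.IsElliptic] [W.IsGloballyMinimal] (p : ℕ) [Fact p.Prime],
      p ≠ 2 → Literature.NumberTheory.EllipticCurves.Rank1Residual.ClassX7 W p → ¬ W.HasCM →
      W.frobeniusTrace p = 0 → ¬ Literature.NumberTheory.EllipticCurves.Rank1Residual.Surj W p →
      (∃ (W' : WeierstrassCurve ℚ) (_ : W'.IsElliptic) (_ : W'.IsGloballyMinimal),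
        W'.HasCM ∧ Literature.NumberTheory.EllipticCurves.Rank1Residual.GoodSS W' p ∧
        W'.frobeniusTrace p = 0 ∧
        (∃ e : geomTorsion W (p : ℤ) ≃+ geomTorsion W' (p : ℤ),
          ∀ (σ : Field.absoluteGaloisGroup ℚ) (P : geomTorsion W (p : ℤ)), e (σ • P) = σ • e P) ∧
        (∀ [NeZero (W'.conductorNorm ℤ)] (f' : CuspForm (Gamma0 (W'.conductorNorm ℤ)) 2),
          IsNewformOf W' f' → ∀ (Lplus Lminus : IwasawaAlgebra p), IsPollackPair f' p Lplus Lminus →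
          ∀ ε : ℤˣ, HasUnitContent (kobayashiL ε Lplus Lminus))) →
      ∃ ε : ℤˣ, Summit.BirchSwinnertonDyer.Rank1Residual.Supersingular.KobayashiLowerDivisibility W p ε := by
  intro W _ _ p _ hp hX _hcm hap _hs hpartner
  obtain ⟨W', _, _, hcm', hss', hap', hiso, hμ'⟩ := hpartner
  exact ⟨1, kobayashiLowerDivisibility_of_mainConjecture
    (kobayashiMainConjecture_of_cmPartner_of_transfer_OPEN W W' p hCL hPR h5 h3 hp hX.1.1 hap hcm' hss'
      hap' hiso hμ' 1)⟩

end Summit.BirchSwinnertonDyer.BirchSwinnertonDyer.Theorems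

end
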